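import Literature.MathematicalPhysics.QuantumFieldTheory.Balaban1983to89.B6Prop27PrintedKLevelV1
import Literature.MathematicalPhysics.QuantumFieldTheory.Balaban1983to89.B6Cor28HolderUnifKLevelV1
import Literature.MathematicalPhysics.QuantumFieldTheory.Balaban1983to89.B6Prop26PrintedKLevelV1
import Literature.MathematicalPhysics.QuantumFieldTheory.Balaban1983to89.B6Prop23KLevelTorusCensus
import Literature.MathematicalPhysics.QuantumFieldTheory.Balaban1983to89.DagBinding

/-!
# NODE 00 (YM-PLAN Track A) — STAGE 3 DEFINITIONS: the k-level tower `B6.BlockData` of record — ONE index (the genuine k-level V1 family at print's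
# units `c_f = L^k`), ONE geometry `kGeoU` («sites replaced by bonds», SUM-typed arguments and cut-offs), the five operator families of Lemma 2.1 ∕
# Props. 2.2, 2.3, 2.6, 2.7 ∕ Cor. 2.8 read through it, and `towerBlockOfRecord` (the conjuncts BY NAME live in `Node00.CarriersB6KLeaves`)

NODE 00 STAGE-3 MODULE (seat `pub-ymgap-node00-def` g27, 2026-08-25; design note `HOME/pub-ymgap-node00-def/STAGE3-SCOPING-g27.md` §2; director-ym LINE №5
(C)(4); the CONVENTIONS OF RECORD block of the root module `Node00.Carriers` applies).  DEFINITIONS ONLY (+ one `rfl` lemma); no estimate; nothing of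
Bałaban's asserted.  APPEND-ONLY GROWTH: a new importing module, no landed module edited; the Stage-3 chain `withB6KOfRecord` ∕ `carriers₃` ∕
`IsWorldOfRecord₃` is the NEXT module (it pins `tree`∕`loc` and substitutes this block for `X.D6`).
HONEST FRAMING: one finite T⁴ programme; NOT ℝ⁴ ∕ infinite volume ∕ OS ∕ mass gap ∕ Clay.  LOCATED READINGS: the arguments `λ` of Props. 2.2∕2.3 are
torus-SITE functions (T8∕p21 lineage, `KTIdx.geoT`), the arguments `J` of Prop. 2.6 are FINE-BOND functions (r03 V1 lineage, `kGeoG`); cut-offs `ζ` likewise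
(site cut-offs for (2.67), fine-bond cut-offs for (2.137)∕(2.151)); the SUM types record both readings side by side and each functional is `0` on the
other summand (the device of r03 g9's one-level `B6Prop22BlockFamily.blockGp`); kernels of Props. 2.3∕2.7, Cor. 2.8 are read at index BONDS through the
carrier block `β` (p. 248 «sites replaced by bonds»; one-level precedent `B6MainResultsOneLevel.bondGeo`).
-/

noncomputable section

namespace Literature.MathematicalPhysics.QuantumFieldTheory.Balaban1983to89.Node00

open LatticeFieldCalculus
open B6SectAOperatorsV1 (BondIdx BondIdxSpace)
open B6MultiLevelBoxOperator (N0)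
open B6MultiLevelTorusOperator (TDomains)
open B6GlobalChartV1 (PV domT blkV1)
open B6Geom246MultiLevelTorus (geomT)
open B6Ineq2142KLevelV1 (lvl β beta_level)
open B6KLevelCensusIndexV1 (KIdx kGeo kGeoG)
open B6Prop22KLevelTorusCensus (KTIdx)
open B6Prop22KLevelTorusCensusEta (geoTP gpTP nKT)
open B6Prop23KLevelTorusCensus (CinvTP prop23Printed_kLevelTorusP)
open B6Prop27PrintedKLevelV1 (kQinv prop27Printed_kLevel)
open B6Cor28PrintedKLevelV1 (kH)
open B6Cor28HolderUnifKLevelV1 (cor28Printed_kLevel)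
open B6Prop26Census2136KLevelV1 (kG)

variable {d ℓ : ℕ} {hd : 1 ≤ d + 1} {hL : Odd (ℓ + 1) ∧ 1 < ℓ + 1} {b₀ b₁ : ℝ}

/-! ## §1. The index of record and its projection to the torus index of Props. 2.2∕2.3 -/

/-- **The projection of the genuine k-level V1 index to the k-level torus index** of the Prop. 2.2∕2.3 censuses (fields `k, Mh, R, P′, D`; the V1
inequalities `k ≥ 2`, `Mh ≥ 8`, `R ≥ 2L²`, `P′ ≥ 5` imply the torus ones `k ≥ 1`, `Mh ≥ 1`, `R ≥ 2L`, `P ≥ 4`).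
[cite: Balaban1984PropagatorsII, (2.1)–(2.4) p.224 (the nested torus family; dictionary)] -/
def toKT (i : KIdx d ℓ hd hL b₀ b₁) : KTIdx d ℓ where
  k := i.k
  Mh := i.Mh
  R := i.R
  P := i.P'
  D := i.D
  hk := le_trans one_le_two i.hk2
  hMh := le_trans (by norm_num) i.hM8
  hR := le_trans (Nat.mul_le_mul_left 2 (Nat.le_self_pow (by norm_num) (ℓ + 1))) i.hR2
  hP4 := fun μ => le_trans (by norm_num) (i.hP5 μ)

variable (d ℓ hd hL b₀ b₁) in
/-- **The index of record**: the genuine k-level V1 family AT PRINT'S UNITS `c_f = L^k` (`η = L^{−k}`, (2.1) p. 224), as a subtype of `KIdx` — every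
census theorem on `KIdx` restricts to it verbatim. [cite: Balaban1984PropagatorsII, (2.1) p.224 («η = L^{−k}»)] -/
def KRIdx : Type := {i : KIdx d ℓ hd hL b₀ b₁ // i.cf = (((ℓ + 1 : ℕ) : ℝ)) ^ i.k}

/-! ## §2. The unified geometry: sites = index bonds, SUM-typed arguments and cut-offs -/

/-- arguments of the operators: a torus-SITE function `λ` (Props. 2.2∕2.3 reading) or a FINE-BOND function `J` (Prop. 2.6 reading).
[cite: Balaban1984PropagatorsII, (2.67) p.234 («supp λ ⊂ B^{j′}(y′)»), (2.136) p.247 («supp J ⊂ Δ(y′)»)] -/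
abbrev KLoc (i : KIdx d ℓ hd hL b₀ b₁) : Type :=
  (↥((toKT i).XB) → ℝ) ⊕ (PBond (PV d ℓ i.m i.K hd hL) 0 → ℝ)

/-- cut-offs: a torus-SITE cut-off (the (2.67) reading) or a FINE-BOND cut-off (the (2.137)∕(2.151) reading).
[cite: Balaban1984PropagatorsII, (2.67) p.234, (2.137) p.247, (2.151) p.249] -/
abbrev KCut (i : KIdx d ℓ hd hL b₀ b₁) : Type :=
  (↥((toKT i).XB) → ℝ) ⊕ (PBond (PV d ℓ i.m i.K hd hL) 0 → ℝ)

/-- **The unified k-level geometry of an index** — `kGeo i` («sites replaced by bonds»: `Site` = index bonds, `scale = level`, `dist` = torus distance of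
the carrier blocks, `η = |c_f|⁻¹`, `M = L·M_h`; `R`-field `:= R − 1`, the reading under which (2.60) holds verbatim on the torus families,
`B6Lemma21ParamKLevelTorus.ineq260_torus` of seat dag-p1) with SUM-typed arguments and cut-offs, every localisation read at the carrier block `β c` of the bond `c`:
site functions ∕ site cut-offs through `KTIdx.geoT`∕`geoTP`, fine-bond functions through `kGeoG`, fine-bond cut-offs through `kGeo`.
[cite: Balaban1984PropagatorsII, (2.1)–(2.4) p.224, (2.45)–(2.46) pp.229–231, p.248 («sites replaced by bonds»), (2.67) p.234, (2.136)–(2.140) p.247, (2.151) p.249] -/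
@[reducible] def kGeoU (i : KIdx d ℓ hd hL b₀ b₁) : B6.Geometry where
  Site := (kGeo i).Site
  fin := (kGeo i).fin
  scale := (kGeo i).scale
  dist := (kGeo i).dist
  k := i.k
  eta := (kGeo i).eta
  L := (kGeo i).L
  R := (i.R : ℝ) - 1   -- the tree's walk form of (2.2) loses one bond per level band (`levelGapT`): (2.60) holds verbatim with `R − 1` (dag-p1, `B6Lemma21ParamKLevelTorus`)
  M := (kGeo i).M
  Hyp21_22 := True
  Loc := KLoc i
  suppIn := fun lam c => match lam with
    | .inl f => (geoTP (toKT i)).suppIn f (β i.hN i.D i.hk c)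
    | .inr J => (kGeoG i).suppIn J (β i.hN i.D i.hk c)
  supNorm := fun lam => match lam with
    | .inl f => (geoTP (toKT i)).supNorm f
    | .inr J => (kGeoG i).supNorm J
  l2Norm := fun lam => match lam with
    | .inl f => (geoTP (toKT i)).l2Norm f
    | .inr J => (kGeoG i).l2Norm J
  holder := fun ε lam => match lam with
    | .inl f => (geoTP (toKT i)).holder ε f
    | .inr J => (kGeoG i).holder ε J
  Cut := KCut i
  cutIn := fun ζ c => match ζ with
    | .inl z => (geoTP (toKT i)).cutIn z (β i.hN i.D i.hk c)
    | .inr z => (kGeo i).cutIn z c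
  cutH := fun α ζ => match ζ with
    | .inl z => (geoTP (toKT i)).cutH α z
    | .inr z => (kGeo i).cutH α z
  cutSup := fun ζ => match ζ with
    | .inl z => (geoTP (toKT i)).cutSup z
    | .inr z => (kGeo i).cutSup z

/-- `(kGeoU i).len = (kGeo i).len` (same `L`, `scale`, `η`). [cite: Balaban1984PropagatorsII, (2.1) p.224, bookkeeping] -/
theorem lenU_eq (i : KIdx d ℓ hd hL b₀ b₁) (b : (kGeoU i).Site) : (kGeoU i).len b = (kGeo i).len b := rfl

/-! ## §3. The five operator families read through `kGeoU` -/

/-- **Cor. 2.8's `H`** on `kGeoU`: r03's `kH` verbatim on the entries; the Hölder slot on fine-bond cut-offs, `0` on site cut-offs.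
[cite: Balaban1984PropagatorsII, Cor. 2.8 (2.150)–(2.151) p.249] -/
def HU (i : KIdx d ℓ hd hL b₀ b₁) : B6.HFamily (kGeoU i) where
  e := (kH i).e
  h := fun α ζ c => match ζ with
    | .inr z => (kH i).h α z c
    | .inl _ => 0

/-- **Prop. 2.7's `(QGQ*)⁻¹` kernel** on `kGeoU`: r03's `kQinv` verbatim. [cite: Balaban1984PropagatorsII, Prop. 2.7 (2.149) p.249] -/
def QinvU (i : KIdx d ℓ hd hL b₀ b₁) : B6.SiteKernel (kGeoU i) := ⟨(kQinv i).ker⟩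

/-- **Prop. 2.6's `G`** on `kGeoU`: r03's `kG` read at the carrier block of the bond, on fine-bond arguments and cut-offs; `0` on the site summands.
[cite: Balaban1984PropagatorsII, Prop. 2.6 (2.136)–(2.140) p.247] -/
def GU (i : KIdx d ℓ hd hL b₀ b₁) : B6.GFamily (kGeoU i) where
  e := fun n lam b => match lam with
    | .inr J => (kG i).e n J (β i.hN i.D i.hk b)
    | .inl _ => 0
  h1 := fun lam α ζ => match lam, ζ with
    | .inr J, .inr z => (kG i).h1 J α z
    | _, _ => 0
  e4 := fun lam b => match lam with
    | .inr J => (kG i).e4 J (β i.hN i.D i.hk b)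
    | .inl _ => 0
  h2 := fun lam α ζ => match lam, ζ with
    | .inr J, .inr z => (kG i).h2 J α z
    | _, _ => 0
  l2 := fun n lam h => match lam, h with
    | .inr J, .inr z => (kG i).l2 n J z
    | _, _ => 0

/-- **Prop. 2.2's `G′`** on `kGeoU`: T8's `gpTP` (print's units) at the projected torus index, read at the carrier block, on site arguments and site
cut-offs; `0` on the bond summands. [cite: Balaban1984PropagatorsII, Prop. 2.2 (2.67) p.234] -/
def GpU (i : KIdx d ℓ hd hL b₀ b₁) : B6.GpFamily (kGeoU i) where
  e := fun n lam b => match lam with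
    | .inl f => (gpTP (toKT i)).e n f (β i.hN i.D i.hk b)
    | .inr _ => 0
  h1 := fun lam α ζ => match lam, ζ with
    | .inl f, .inl z => (gpTP (toKT i)).h1 f α z
    | _, _ => 0

/-- **Prop. 2.3's `(Q′G′²Q′*)⁻¹` kernel** on `kGeoU`: T8's `CinvTP` at the projected torus index, read at the carrier blocks of the two bonds.
[cite: Balaban1984PropagatorsII, Prop. 2.3 (2.86)–(2.87) p.238] -/
def CinvU (i : KIdx d ℓ hd hL b₀ b₁) : B6.SiteKernel (kGeoU i) :=
  ⟨fun b b' => (CinvTP (toKT i)).ker (β i.hN i.D i.hk b) (β i.hN i.D i.hk b')⟩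

/-! ## §4. The tower block of record (tree-gauge and local-operator families as parameters, as in the one-level `knitBlock`) -/

variable (d ℓ hd hL b₀ b₁) in
/-- **The k-level tower `BlockData` of record**: index `KRIdx` (print's units), geometry `kGeoU`, the five operator families above; the index-independent
tree-gauge data of Lemma 2.4 and local operators of Prop. 2.5 are parameters (the one-level carriers of `B6BlockParamOneLevel.knitBlock` are the intended
arguments). [cite: Balaban1984PropagatorsII, pp.223–250 (the carriers of the stated block)] -/
def towerBlockOfRecord (δ₀ : ℝ) {Jt Kt : Type} (tree : Jt → B6.TreeData) (loc : Kt → B6.LocalOp) : B6.BlockData where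
  I := KRIdx d ℓ hd hL b₀ b₁
  d := d + 1
  L := ((ℓ + 1 : ℕ) : ℝ)
  δ₀ := δ₀
  geo := fun i => kGeoU i.1
  Gp := fun i => GpU i.1
  Cinv := fun i => CinvU i.1
  G := fun i => GU i.1
  Qinv := fun i => QinvU i.1
  H := fun i => HU i.1
  J := Jt
  tree := tree
  K := Kt
  loc := loc

end Literature.MathematicalPhysics.QuantumFieldTheory.Balaban1983to89.Node00

end
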